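import Literature.AnabelianGeometry.SemiGraphs.TemperedAbsolutenessReductionsConverse
import Literature.AnabelianGeometry.SemiGraphs.TemperedDecompositionOfProfinite
import HarnessLib

/-!
# [SemiAnbd] Cor. 6.10 / Cor. 6.11 (F-1656 / F-1655): the conditional closers re-based on NAMED LEAVES —
# [Mzk8] Thm. 1.3 (i), (ii) at the profinite completion (the binder shapes of the F-1708 reduction),
# compactness of decomposition groups (GAP row G-L5t11g4-1), and two structure laws of [Mzk8] §4

Mochizuki, *Semi-graphs of anabelioids*, Publ. RIMS **42** (2006) [SemiAnbd], §6, Cor. 6.10 (Tempered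
Absoluteness) (i), (ii) and Cor. 6.11, manuscript p. 77 (proof of Cor. 6.11: p. 78 l. 1–2), over [Mzk8] =
Mochizuki, *Galois sections in absolute anabelian geometry*, Nagoya Math. J. **179** (2005), Thm. 1.3 p. 6,
§4 pp. 33–34 (Def. 4.1), Cor. 4.11. [cite: MochizukiSemiAnbd2006, Cor 6.10 p.77]
[cite: MochizukiSemiAnbd2006, Cor 6.11 pp.77-78] [cite: MochizukiGalSect2005, Thm 1.3 p.6]

PROOF-ONLY successor (abc-iut cell, D-0079 L-F sub-cell [SemiAnbd]+[CombGC], pack D «§6 tempered anabelian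
(deep)», table `plan/L3/LF-SGA.tsv` rows F-1656 / F-1655; seat abc-iut-f-168 gen 5) of this seat's gen-0
closers `AbsolutenessOrigin.temperedAbsolutenessHolds_of_laws` / `genusZeroTempAbsolutenessHolds_of_laws`
(`TemperedAbsolutenessReductionsConverse.lean`, p433627; joint non-vacuity p441779).  No definition, no new
named fact, nothing of the frozen interfaces restated.  Those closers carry, besides the FACT-LIST leaves
`h66` = F-1707 (Thm. 6.6) and `h65` = F-1704 (Thm. 6.5 (iii)), five anonymous «interface laws» (`hgood`,
`hcpt`, `hrig`, `hnorm`, `hnormI`).  Here THREE of them are DERIVED from leaves that already have a name in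
the cell:

* `hrig` (two cusps whose `D̂`'s are `Π_{Y_L}`-conjugate coincide) ⟸ **[Mzk8] Thm. 1.3 (i)** for the images
  `ι(D_y) ⊆ Π_{Y_L}` — VERBATIM the binder `h13i` of abc-iut-f-174's F-1708 reduction
  (`TemperedCurve.decompDeterminesPoint_of_hat`, `TemperedDecompositionOfProfinite.lean`), so that ONE leaf serves
  Thm. 6.5 (i) AND Cor. 6.10 — plus compactness of the decomposition groups `D_y` (`D̂_y = ι(D_y)`,
  `map_toHat_eq_topologicalClosure_of_isCompact`), which is the cell's GAP row **G-L5t11g4-1** («FIELD wanted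
  `isCompact_decomp`» on `TemperedCurve`);
* `hnorm` / `hnormI` (an element of `Π_{Y_L}` normalising `D̂_y` preserves `hatOf` of the canonical structures
  at `y`) ⟸ **[Mzk8] Thm. 1.3 (ii)** (commensurable terminality of `ι(D_y)`; VERBATIM f-174's binder `h13ii`
  of `decompCommensurablyTerminal_of_hat`) + G-L5t11g4-1 + the STRUCTURE LAW «the canonical structures at a
  cusp `y` are stable under conjugation by `D_y`» ([Mzk8] §4 p. 33: a structure is a union of
  `H¹(G_K, I_x)`-classes of sections of `D_x ↠ G_K`, and conjugating a section by an element of `D_x` changes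
  it by a coboundary): a normalising `ε` is commensurating, hence `ε = ι(t)` with `t ∈ D_y`, and
  `ι(t)·hatOf(𝒮)·ι(t)⁻¹ = hatOf(t 𝒮 t⁻¹) = hatOf(𝒮)`;
* `hcpt` (members of the canonical discrete structures are compact) ⟸ G-L5t11g4-1 + the STRUCTURE LAW
  «members of the canonical structures at a cusp `y` are closed subgroups of `D_y`» ([Mzk8] §4 p. 33: images
  of continuous sections; for a `K`-RATIONAL cusp this is the typed field
  `CuspidalStructures.isSplitting_of_mem`, the law only adds the non-rational cusps, where [Mzk8] defines no
  structure and the typed record is unconstrained).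

Results: `TemperedCurve.decompHat_eq_map_of_isCompact`, `decompHat_rigid_of_thm13i`,
`exists_eq_toHat_of_smul_decompHat_eq`, `image_smul_hatOf_eq_of_stable` (the three derivations, pure
topological-group bookkeeping over the §6 interface) and the re-based closers
`AbsolutenessOrigin.temperedAbsolutenessHolds_of_leaves` (F-1656) /
`genusZeroTempAbsolutenessHolds_of_leaves` (F-1655; `+ hCor411` = [Mzk8] Cor. 4.11, absolute form, as
before).  LEAVES after this file, all NAMED in the cell's books: F-1707, F-1704 (FACT-LIST, pack D);
[Mzk8] Thm. 1.3 (i)/(ii) at `Π_{X_K}` (f-174's shapes; the L4 typing `GalSect.Thm_1_3_ii_*` lives over another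
interface — bridge not claimed); G-L5t11g4-1; the Kummer-transport functoriality law `hgood`
(«`Π^temp_{X_K}` is also good», p. 77); the two structure laws above; [Mzk8] Cor. 4.11 (F-1655 only).
HONEST FRAMING: statements about OUR typed interface of a refereed prerequisite paper; the leaves are
displayed hypotheses, never asserted; the `∀Ω` closures of F-1655/F-1656 stay refuted (p431240) — these rows
have content only at certified data; nothing here bears on, or takes a side on, [IUTchIII] Cor. 3.12;
typed ≠ proved.
-/

noncomputable section

namespace Literature.AnabelianGeometry.SemiGraphs

open scoped Pointwise
open _root_.Topology

variable {p : ℕ} [Fact p.Prime]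

namespace TemperedCurve

variable {Y : TemperedCurve p}

/-- Under compactness of `D_y` the "profinite `D_y`" `D̂_y = closure ι(D_y)` (p. 77) IS the image `ι(D_y)`
(compact image in the Hausdorff `Π_{Y_L}`). [cite: MochizukiSemiAnbd2006, §6 p.77] -/
theorem decompHat_eq_map_of_isCompact (y : Y.Pt) (hD : IsCompact (Y.decomp y : Set Y.PiTemp)) :
    Y.decompHat y = (Y.decomp y).map Y.toHat.toMonoidHom :=
  (Y.map_toHat_eq_topologicalClosure_of_isCompact (Y.decomp y) hD).2

/-- **The profinite cuspidal rigidity law `hrig` of p433627 FROM [Mzk8] Thm. 1.3 (i)** (in the binder shape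
`h13i` of `decompDeterminesPoint_of_hat`: `Π_{Y_L}`-conjugate images `ι(D_x)`, `ι(D_{x'})` force `x' = x`)
under compactness of the decomposition groups: two cusps whose `D̂`'s are `Π_{Y_L}`-conjugate coincide.
[cite: MochizukiGalSect2005, Thm 1.3 p.6] -/
theorem decompHat_rigid_of_thm13i (hDc : ∀ y : Y.Pt, IsCompact (Y.decomp y : Set Y.PiTemp))
    (h13i : ∀ x x' : Y.Pt, (∃ γ : ConjAct Y.PiHat,
        (Y.decomp x').map Y.toHat.toMonoidHom = γ • (Y.decomp x).map Y.toHat.toMonoidHom) → x' = x) :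
    ∀ y y' : Y.Pt, Y.IsCusp y → Y.IsCusp y' →
      (∃ g : ConjAct Y.PiHat, Y.decompHat y' = g • Y.decompHat y) → y' = y := by
  rintro y y' - - ⟨g, hg⟩
  refine h13i y y' ⟨g, ?_⟩
  rw [← decompHat_eq_map_of_isCompact y' (hDc y'), ← decompHat_eq_map_of_isCompact y (hDc y), hg]

/-- **An element of `Π_{Y_L}` normalising `D̂_y` lies in `ι(D_y)`**, from [Mzk8] Thm. 1.3 (ii) (commensurable
terminality of `ι(D_y)`, binder shape `h13ii` of `decompCommensurablyTerminal_of_hat`) and compactness of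
`D_y`: a normalising element commensurates. [cite: MochizukiGalSect2005, Thm 1.3 p.6] -/
theorem exists_eq_toHat_of_smul_decompHat_eq (y : Y.Pt) (hD : IsCompact (Y.decomp y : Set Y.PiTemp))
    (h13ii : Subgroup.Commensurable.commensurator ((Y.decomp y).map Y.toHat.toMonoidHom) =
      (Y.decomp y).map Y.toHat.toMonoidHom)
    (ε : ConjAct Y.PiHat) (hε : ε • Y.decompHat y = Y.decompHat y) :
    ∃ t ∈ Y.decomp y, ConjAct.ofConjAct ε = Y.toHat t := by
  rw [decompHat_eq_map_of_isCompact y hD] at hε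
  have hmem : ConjAct.ofConjAct ε ∈
      Subgroup.Commensurable.commensurator ((Y.decomp y).map Y.toHat.toMonoidHom) := by
    rw [Subgroup.Commensurable.commensurator_mem_iff, ConjAct.toConjAct_ofConjAct, hε]
  rw [h13ii, Subgroup.mem_map] at hmem
  obtain ⟨t, ht, hte⟩ := hmem
  exact ⟨t, ht, hte.symm⟩

/-- **The normaliser-invariance laws `hnorm` / `hnormI` of p433627 FROM [Mzk8] Thm. 1.3 (ii) + compactness of
`D_y` + `D_y`-stability of the family `𝒮`**: if `ε ∈ Π_{Y_L}` normalises `D̂_y` then `ε = ι(t)` with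
`t ∈ D_y`, and `ε · hatOf(𝒮) · ε⁻¹ = hatOf(t 𝒮 t⁻¹) = hatOf(𝒮)`. [cite: MochizukiSemiAnbd2006, §6 p.77] -/
theorem image_smul_hatOf_eq_of_stable (y : Y.Pt) (hD : IsCompact (Y.decomp y : Set Y.PiTemp))
    (h13ii : Subgroup.Commensurable.commensurator ((Y.decomp y).map Y.toHat.toMonoidHom) =
      (Y.decomp y).map Y.toHat.toMonoidHom)
    (𝒮 : Set (Subgroup Y.PiTemp)) (hstab : ∀ t ∈ Y.decomp y, ∀ S ∈ 𝒮, ConjAct.toConjAct t • S ∈ 𝒮)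
    (ε : ConjAct Y.PiHat) (hε : ε • Y.decompHat y = Y.decompHat y) :
    (fun S => ε • S) '' Y.hatOf 𝒮 = Y.hatOf 𝒮 := by
  obtain ⟨t, ht, hte⟩ := exists_eq_toHat_of_smul_decompHat_eq y hD h13ii ε hε
  have hε' : ε = ConjAct.toConjAct (Y.toHat (ConjAct.ofConjAct (ConjAct.toConjAct t))) := by
    rw [ConjAct.ofConjAct_toConjAct, ← hte, ConjAct.toConjAct_ofConjAct]
  rw [hε', image_conj_hatOf_eq]
  congr 1
  refine Set.Subset.antisymm ?_ fun S hS => ?_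
  · rintro _ ⟨S, hS, rfl⟩
    exact hstab t ht S hS
  · refine ⟨(ConjAct.toConjAct t)⁻¹ • S, ?_, smul_inv_smul _ _⟩
    rw [← map_inv]
    exact hstab t⁻¹ (inv_mem ht) S hS

end TemperedCurve

/-! ### The re-based closers -/

namespace AbsolutenessOrigin

variable (Ω : AbsolutenessOrigin p)

/-- **F-1656 `TemperedAbsolutenessHolds Ω` ([SemiAnbd] Cor. 6.10 (i), (ii)) FROM NAMED LEAVES**: Thm. 6.6
(`h66`, F-1707) and Thm. 6.5 (iii) (`h65`, F-1704); [Mzk8] Thm. 1.3 (i) and (ii) for the images `ι(D_x)` in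
the profinite completions of the certified curves (`h13i`, `h13ii` — the binder shapes of the F-1708
reduction `TemperedDecompositionOfProfinite.lean`); compactness of the decomposition groups (`hDc`, GAP row
G-L5t11g4-1); the Kummer-transport functoriality law (`hgood`, p. 77 «`Π^temp_{X_K}` is also good»); and the
two [Mzk8] §4 structure laws `hsub` (members of the canonical structures at a cusp are closed subgroups of
`D_y`) and `hstab` (the canonical structures at a cusp are `D_y`-conjugation stable).  Composition of the
three derivations of this file with the gen-0 closer `temperedAbsolutenessHolds_of_laws` (p433627).
[cite: MochizukiSemiAnbd2006, Cor 6.10 p.77] -/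
theorem temperedAbsolutenessHolds_of_leaves
    (h66 : Ω.toTemperedOrigin.ProfiniteOuterIsoLiftsHolds)
    (h65 : Ω.toTemperedOrigin.CuspidalAbsolutenessHolds)
    (h13i : ∀ Y : TemperedCurve p, Ω.IsHyperbolicCurveOrigin Y → ∀ x x' : Y.Pt,
      (∃ γ : ConjAct Y.PiHat,
        (Y.decomp x').map Y.toHat.toMonoidHom = γ • (Y.decomp x).map Y.toHat.toMonoidHom) → x' = x)
    (h13ii : ∀ Y : TemperedCurve p, Ω.IsHyperbolicCurveOrigin Y → ∀ x : Y.Pt,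
      Subgroup.Commensurable.commensurator ((Y.decomp x).map Y.toHat.toMonoidHom) =
        (Y.decomp x).map Y.toHat.toMonoidHom)
    (hDc : ∀ Y : TemperedCurve p, Ω.IsHyperbolicCurveOrigin Y → ∀ y : Y.Pt,
      IsCompact (Y.decomp y : Set Y.PiTemp))
    (hgood : ∀ (X : TemperedCurve p) (kX : KummerUnitData X), Ω.IsHyperbolicCurveOrigin X →
      Ω.IsKummerOrigin kX → ∀ (Y : TemperedCurve p) (kY : KummerUnitData Y) (t : KummerTransport kX kY),
      Ω.IsHyperbolicCurveOrigin Y → Ω.IsKummerOrigin kY → Ω.IsKummerTransportOrigin t →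
      ∀ (αhat : X.PiHat ≃ₜ* Y.PiHat) (β : X.PiTemp ≃ₜ* Y.PiTemp), TemperedCurve.LiesUnder X Y αhat β →
        (kX.unitImage).map (t.h1OfHat αhat).toAddMonoidHom =
          (kX.unitImage).map (t.h1OfTemp β).toAddMonoidHom)
    (hsub : ∀ (Y : TemperedCurve p) (SY : CuspidalStructures Y), Ω.IsHyperbolicCurveOrigin Y →
      Ω.IsStructuresOrigin SY → ∀ y : Y.Pt, Y.IsCusp y → ∀ S ∈ SY.canonicalDiscrete y,
        IsClosed (S : Set Y.PiTemp) ∧ S ≤ Y.decomp y)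
    (hstab : ∀ (Y : TemperedCurve p) (SY : CuspidalStructures Y), Ω.IsHyperbolicCurveOrigin Y →
      Ω.IsStructuresOrigin SY → ∀ y : Y.Pt, Y.IsCusp y → ∀ t ∈ Y.decomp y,
        (∀ S ∈ SY.canonicalDiscrete y, ConjAct.toConjAct t • S ∈ SY.canonicalDiscrete y) ∧
          ∀ S ∈ SY.canonicalIntegral y, ConjAct.toConjAct t • S ∈ SY.canonicalIntegral y) :
    Ω.TemperedAbsolutenessHolds :=
  Ω.temperedAbsolutenessHolds_of_laws h66 h65 hgood
    (fun Y SY hY hSY y hy S hS =>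
      (hDc Y hY y).of_isClosed_subset (hsub Y SY hY hSY y hy S hS).1 (hsub Y SY hY hSY y hy S hS).2)
    (fun Y hY => TemperedCurve.decompHat_rigid_of_thm13i (hDc Y hY) (h13i Y hY))
    (fun Y SY hY hSY y hy ε hε => TemperedCurve.image_smul_hatOf_eq_of_stable y (hDc Y hY y) (h13ii Y hY y)
      _ (fun t ht S hS => (hstab Y SY hY hSY y hy t ht).1 S hS) ε hε)
    (fun Y SY hY hSY y hy ε hε => TemperedCurve.image_smul_hatOf_eq_of_stable y (hDc Y hY y) (h13ii Y hY y)
      _ (fun t ht S hS => (hstab Y SY hY hSY y hy t ht).2 S hS) ε hε)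

/-- **F-1655 `GenusZeroTempAbsolutenessHolds Ω` ([SemiAnbd] Cor. 6.11) FROM NAMED LEAVES**: the leaves of
`temperedAbsolutenessHolds_of_leaves` plus the ABSOLUTE [Mzk8] Cor. 4.11 (`hCor411`), through the printed
one-line proof (p. 78 l. 1–2) `genusZeroTempAbsolutenessHolds_of_temperedAbsolutenessHolds` (p433257).
[cite: MochizukiSemiAnbd2006, Cor 6.11 pp.77-78] -/
theorem genusZeroTempAbsolutenessHolds_of_leaves
    (h66 : Ω.toTemperedOrigin.ProfiniteOuterIsoLiftsHolds)
    (h65 : Ω.toTemperedOrigin.CuspidalAbsolutenessHolds)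
    (h13i : ∀ Y : TemperedCurve p, Ω.IsHyperbolicCurveOrigin Y → ∀ x x' : Y.Pt,
      (∃ γ : ConjAct Y.PiHat,
        (Y.decomp x').map Y.toHat.toMonoidHom = γ • (Y.decomp x).map Y.toHat.toMonoidHom) → x' = x)
    (h13ii : ∀ Y : TemperedCurve p, Ω.IsHyperbolicCurveOrigin Y → ∀ x : Y.Pt,
      Subgroup.Commensurable.commensurator ((Y.decomp x).map Y.toHat.toMonoidHom) =
        (Y.decomp x).map Y.toHat.toMonoidHom)
    (hDc : ∀ Y : TemperedCurve p, Ω.IsHyperbolicCurveOrigin Y → ∀ y : Y.Pt,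
      IsCompact (Y.decomp y : Set Y.PiTemp))
    (hgood : ∀ (X : TemperedCurve p) (kX : KummerUnitData X), Ω.IsHyperbolicCurveOrigin X →
      Ω.IsKummerOrigin kX → ∀ (Y : TemperedCurve p) (kY : KummerUnitData Y) (t : KummerTransport kX kY),
      Ω.IsHyperbolicCurveOrigin Y → Ω.IsKummerOrigin kY → Ω.IsKummerTransportOrigin t →
      ∀ (αhat : X.PiHat ≃ₜ* Y.PiHat) (β : X.PiTemp ≃ₜ* Y.PiTemp), TemperedCurve.LiesUnder X Y αhat β →
        (kX.unitImage).map (t.h1OfHat αhat).toAddMonoidHom =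
          (kX.unitImage).map (t.h1OfTemp β).toAddMonoidHom)
    (hsub : ∀ (Y : TemperedCurve p) (SY : CuspidalStructures Y), Ω.IsHyperbolicCurveOrigin Y →
      Ω.IsStructuresOrigin SY → ∀ y : Y.Pt, Y.IsCusp y → ∀ S ∈ SY.canonicalDiscrete y,
        IsClosed (S : Set Y.PiTemp) ∧ S ≤ Y.decomp y)
    (hstab : ∀ (Y : TemperedCurve p) (SY : CuspidalStructures Y), Ω.IsHyperbolicCurveOrigin Y →
      Ω.IsStructuresOrigin SY → ∀ y : Y.Pt, Y.IsCusp y → ∀ t ∈ Y.decomp y,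
        (∀ S ∈ SY.canonicalDiscrete y, ConjAct.toConjAct t • S ∈ SY.canonicalDiscrete y) ∧
          ∀ S ∈ SY.canonicalIntegral y, ConjAct.toConjAct t • S ∈ SY.canonicalIntegral y)
    (hCor411 : ∀ (X : TemperedCurve p) (SX : CuspidalStructures X) (kX : KummerUnitData X)
      (aX : TemperedCurve.CurveArithmeticFlags X), Ω.IsHyperbolicCurveOrigin X →
      Ω.IsStructuresOrigin SX → Ω.IsKummerOrigin kX → Ω.IsFlagsOrigin aX →
      SX.HasStableReduction → aX.IsIsogenousToGenusZero →
        Ω.IsUnitwiseAbsolute kX ∧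
          ∀ x : X.Pt, X.IsCusp x → X.IsRationalPt x → Ω.IsIntegrallyAbsoluteCusp SX x) :
    Ω.GenusZeroTempAbsolutenessHolds :=
  Ω.genusZeroTempAbsolutenessHolds_of_temperedAbsolutenessHolds
    (Ω.temperedAbsolutenessHolds_of_leaves h66 h65 h13i h13ii hDc hgood hsub hstab) hCor411

end AbsolutenessOrigin

end Literature.AnabelianGeometry.SemiGraphs

end
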